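import Mathlib
import HarnessLib
import Literature.MathematicalPhysics.QuantumFieldTheory.ConstructiveQFTWave0
import Literature.MathematicalPhysics.QuantumLattice.AbelianFieldTensor
import Literature.MathematicalPhysics.QuantumLattice.AbelianMagneticFlux
import Summits.Ventures.LatticeQCDFlow.Scaling.FluxSectorCollar
import Summits.Ventures.LatticeQCDFlow.Scaling.FluxPatch
import Summits.Ventures.LatticeQCDFlow.Scaling.FluxTunnelling
import Summits.Ventures.LatticeQCDFlow.Scaling.SliceTwistWitness
import Summits.Ventures.LatticeQCDFlow.Scaling.ThinPairs
import Summits.Ventures.LatticeQCDFlow.Scaling.RowFields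

/-!
# LatticeQCDFlow / Scaling — the balanced slice twist: the flux threshold of a wrapping line is exactly `2 sin(π/(2L))` (v3.6, (C7b″) sharp form, part 3 of 4)

HONEST FRAMING: exact (Metropolis-corrected) sampling algorithms for lattice gauge theory; figures
of merit are autocorrelation/cost numbers at stated couplings and volumes; no continuum-physics
claim.

THEORY-2.md §4 (C7(b″)), §5.17.  `U(1) = Circle`, `d = 2`, torus `(ℤ/L)²`, `2 ≤ L`; update set =
the WRAPPING LINE `sliceLinks L` (the `L` direction-`0` links based on `{x | x 0 = 0}`).

`SliceTwistPair.lean` showed: no thin-plaquette tunnelling law for `sliceLinks L` with a threshold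
`c > 2π/L` (atoms `1` and `sliceTwist L`, the latter with `L` plaquettes at angle `-2π/L`), while the
sharp patch law of `FluxTunnelling.lean` gives one at `S_P ≥ L(1 - cos(π/L))`, i.e. — in the
max-plaquette currency of `RowFields.lean` — at `c = 2 sin(π/(2L))`, angle `π/L`: a factor `2` apart.
This file closes the factor:

* **§1–§2 the balanced pair.**  The LINE BACKGROUND `B_L = rowField (lineRate L)` has plaquette angle
  `+π/L` on row `0` and `-π/(L(L-1))` on the other `L - 1` rows, flux charge `0`; the BALANCED TWIST
  `A_L = B_L · sliceTwist L` has angle `-π/L` on row `0`, the same elsewhere, flux charge `-1`; both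
  are `2 sin(π/(2L))`-thin and they AGREE OFF `sliceLinks L`.  (The unit of flux that the twist
  removes from row `0` is split evenly between the states before and after.)
* **§3 necessity, sharp.**  For every `c > 2 sin(π/(2L))` and every constant `C`, the flux law
  `(μ ⊗ κ){Q ≠ Q'} ≤ C·μ{∃ p, dist(U_p,1) ≥ c}` FAILS for some `μ`-invariant Markov pair moving only
  `sliceLinks L` (`not_fluxLaw_sliceLinks_sharp`); so does the `ε`-sector law for
  `2 sin(π/(2L)) < ε ≤ 2` (`not_sectorLaw_sliceLinks_sharp`), and so does the patch-action law of
  `FluxTunnelling.lean` for every threshold `t > L(1 - cos(π/L))` (`not_patchLaw_sliceLinks_sharp`: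
  both atoms have `S_P = L(1 - cos(π/L))` exactly on the line positions `P = {0} × ℤ/L`).
* **§4 sufficiency at the same number.**  Every `μ`-invariant Markov pair moving only `sliceLinks L`
  satisfies `(μ ⊗ κ){Q ≠ Q'} ≤ 2·μ{∃ p, dist(U_p,1) ≥ 2 sin(π/(2L))}`
  (`fluxLaw_sliceLinks_sharp`, from `compProd_topCharge_ne_le_of_links_maxPlaquette` with
  `#P = L`).  THE ADMISSIBLE FLUX THRESHOLD OF A WRAPPING LINE OF `L` LINKS IS EXACTLY
  `2 sin(π/(2L))`, and the constant `2` and the threshold `L(1 - cos(π/L))` of the sharp patch law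
  cannot be improved (the balanced pair sits on its boundary; the unbalanced pair of
  `SliceTwistPair.lean` shows `2` is attained as `(μ ⊗ κ){Q ≠ Q'}/μ{S_P ≥ t} = 1/(1/2)`).
  For `ε`-SECTORS the positive side at the sharp threshold is conjecture C8 of THEORY-2.md
  (`ε`-thin components = flux sectors for `ε ≤ 2`; only `⊆` is proved, `SliceTwistWitness.lean`).
-/

noncomputable section

namespace Summit.Ventures.LatticeQCDFlow.Theory2.Lattice.Flux

open MeasureTheory ProbabilityTheory Metric Set Filter Topology Real
open scoped ENNReal
open Literature.MathematicalPhysics.QuantumFieldTheory Literature.MathematicalPhysics.QuantumLattice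

/-! ## §1. The row rates -/

section Rates

variable {L : ℕ}

/-- Row rates of the LINE BACKGROUND: `π/L` on row `0`, `-π/(L(L-1))` on the other rows. [folklore] -/
def lineRate (L : ℕ) (v : ℕ) : ℝ :=
  if v = 0 then π / L else -(π / ((L : ℝ) * ((L : ℝ) - 1)))

/-- Row rates of the BALANCED TWIST: `-π/L` on row `0`, `-π/(L(L-1))` on the other rows. [folklore] -/
def twistRate (L : ℕ) (v : ℕ) : ℝ :=
  if v = 0 then -(π / L) else -(π / ((L : ℝ) * ((L : ℝ) - 1)))

/-- The background rates sum to zero over a period. [folklore] -/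
theorem sum_lineRate (hL : 2 ≤ L) : ∑ v ∈ Finset.range L, lineRate L v = 0 := by
  obtain ⟨n, rfl⟩ : ∃ n, L = n + 1 := ⟨L - 1, by omega⟩
  have hn : (n : ℝ) ≠ 0 := by exact_mod_cast (show n ≠ 0 by omega)
  have hn1 : (n : ℝ) + 1 ≠ 0 := by positivity
  rw [Finset.sum_range_succ']
  simp only [lineRate, Nat.add_one_ne_zero, if_false, if_true, Finset.sum_const, Finset.card_range,
    nsmul_eq_mul]
  push_cast
  rw [add_sub_cancel_right]
  field_simp
  ring

/-- The twist rates sum to `-2π/L` over a period. [folklore] -/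
theorem sum_twistRate (hL : 2 ≤ L) : ∑ v ∈ Finset.range L, twistRate L v = -(2 * π / L) := by
  obtain ⟨n, rfl⟩ : ∃ n, L = n + 1 := ⟨L - 1, by omega⟩
  have hn : (n : ℝ) ≠ 0 := by exact_mod_cast (show n ≠ 0 by omega)
  have hn1 : (n : ℝ) + 1 ≠ 0 := by positivity
  rw [Finset.sum_range_succ']
  simp only [twistRate, Nat.add_one_ne_zero, if_false, if_true, Finset.sum_const, Finset.card_range,
    nsmul_eq_mul]
  push_cast
  rw [add_sub_cancel_right]
  field_simp
  ring

/-- `π/(L(L-1)) ≤ π/L` for `2 ≤ L`. [folklore] -/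
theorem pi_div_mul_le (hL : 2 ≤ L) : π / ((L : ℝ) * ((L : ℝ) - 1)) ≤ π / L := by
  have hL2 : (2 : ℝ) ≤ L := by exact_mod_cast hL
  exact div_le_div_of_nonneg_left Real.pi_pos.le (by positivity) (by nlinarith)

/-- `0 ≤ π/(L(L-1))` for `2 ≤ L`. [folklore] -/
theorem pi_div_mul_nonneg (hL : 2 ≤ L) : 0 ≤ π / ((L : ℝ) * ((L : ℝ) - 1)) := by
  have hL2 : (2 : ℝ) ≤ L := by exact_mod_cast hL
  exact div_nonneg Real.pi_pos.le (mul_nonneg (by linarith) (by linarith))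

/-- `|lineRate| ≤ π/L`. [folklore] -/
theorem abs_lineRate_le (hL : 2 ≤ L) (v : ℕ) : |lineRate L v| ≤ π / L := by
  unfold lineRate
  split_ifs
  · rw [abs_of_nonneg (by positivity)]
  · rw [abs_neg, abs_of_nonneg (pi_div_mul_nonneg hL)]
    exact pi_div_mul_le hL

/-- `|twistRate| ≤ π/L`. [folklore] -/
theorem abs_twistRate_le (hL : 2 ≤ L) (v : ℕ) : |twistRate L v| ≤ π / L := by
  unfold twistRate
  split_ifs
  · rw [abs_neg, abs_of_nonneg (by positivity)]
  · rw [abs_neg, abs_of_nonneg (pi_div_mul_nonneg hL)]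
    exact pi_div_mul_le hL

/-- `π/L ≤ π/2 < π` for `2 ≤ L`. [folklore] -/
theorem pi_div_lt_pi (hL : 2 ≤ L) : π / (L : ℝ) < π := by
  have hL2 : (2 : ℝ) ≤ L := by exact_mod_cast hL
  rw [div_lt_iff₀ (by positivity)]
  nlinarith [Real.pi_pos]

/-- A rate of size `≤ π/L` lies in the principal branch. [folklore] -/
theorem mem_branch_of_abs_le (hL : 2 ≤ L) {r : ℝ} (h : |r| ≤ π / L) : -π < r ∧ r ≤ π := by
  have h1 := pi_div_lt_pi hL
  obtain ⟨ha, hb⟩ := abs_le.mp h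
  exact ⟨by linarith, by linarith⟩

end Rates

/-! ## §2. The line background and the balanced twist -/

section Balanced

variable {L : ℕ} [NeZero L]

/-- **The line background** `B_L`: the row field with rates `lineRate L` (charge `0`, plaquette angle
`π/L` on row `0`, `-π/(L(L-1))` elsewhere). [folklore] -/
def lineBackground (L : ℕ) [NeZero L] : GaugeConfig 2 L Circle := rowField (lineRate L)

/-- **The balanced slice twist** `A_L = B_L · sliceTwist L` (charge `-1`, plaquette angle `-π/L` on
row `0`, `-π/(L(L-1))` elsewhere). [cite: AlbandeaEtAl2021, §3] [folklore] -/
def balancedTwist (L : ℕ) [NeZero L] : GaugeConfig 2 L Circle := lineBackground L * sliceTwist L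

/-- The plaquettes of the line background. [folklore] -/
theorem plaquetteHolonomy_lineBackground (hL : 2 ≤ L) (x : Site 2 L) :
    plaquetteHolonomy (lineBackground L) x 0 1 = Circle.exp (lineRate L (x 0).val) :=
  plaquetteHolonomy_rowField (by omega) (sum_lineRate hL) x

/-- The plaquettes of the balanced twist. [folklore] -/
theorem plaquetteHolonomy_balancedTwist (hL : 2 ≤ L) (x : Site 2 L) :
    plaquetteHolonomy (balancedTwist L) x 0 1 = Circle.exp (twistRate L (x 0).val) := by
  rw [balancedTwist, plaquetteHolonomy_mul', plaquetteHolonomy_lineBackground hL,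
    plaquetteHolonomy_sliceTwist]
  have hv : (x 0).val = 0 ↔ x 0 = 0 := ZMod.val_eq_zero _
  by_cases h0 : x 0 = 0
  · rw [if_pos h0, toCircle_one_eq_exp, ← Circle.exp_neg, ← Circle.exp_add, lineRate, twistRate,
      if_pos (hv.mpr h0), if_pos (hv.mpr h0)]
    congr 1
    ring
  · rw [if_neg h0, mul_one, lineRate, twistRate, if_neg (fun h => h0 (hv.mp h)),
      if_neg (fun h => h0 (hv.mp h))]

/-- The field tensor of the line background. [folklore] -/
theorem abelianFieldTensor_lineBackground (hL : 2 ≤ L) (x : Site 2 L) :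
    abelianFieldTensor (lineBackground L) x 0 1 = lineRate L (x 0).val :=
  abelianFieldTensor_eq_of_plaquette_eq_exp (plaquetteHolonomy_lineBackground hL x)
    (mem_branch_of_abs_le hL (abs_lineRate_le hL _)).1
    (mem_branch_of_abs_le hL (abs_lineRate_le hL _)).2

/-- The field tensor of the balanced twist. [folklore] -/
theorem abelianFieldTensor_balancedTwist (hL : 2 ≤ L) (x : Site 2 L) :
    abelianFieldTensor (balancedTwist L) x 0 1 = twistRate L (x 0).val :=
  abelianFieldTensor_eq_of_plaquette_eq_exp (plaquetteHolonomy_balancedTwist hL x)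
    (mem_branch_of_abs_le hL (abs_twistRate_le hL _)).1
    (mem_branch_of_abs_le hL (abs_twistRate_le hL _)).2

/-- **The line background has flux charge `0`.** [folklore] -/
theorem topCharge_lineBackground (hL : 2 ≤ L) :
    topCharge (0 : Site 2 L) 0 1 (lineBackground L) = 0 := by
  rw [topCharge_of_row (abelianFieldTensor_lineBackground hL), sum_lineRate hL, mul_zero, zero_div]

/-- **The balanced twist has flux charge `-1`.** [folklore] -/
theorem topCharge_balancedTwist (hL : 2 ≤ L) :
    topCharge (0 : Site 2 L) 0 1 (balancedTwist L) = -1 := by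
  have hL0 : (L : ℝ) ≠ 0 := by exact_mod_cast (show L ≠ 0 by omega)
  rw [topCharge_of_row (abelianFieldTensor_balancedTwist hL), sum_twistRate hL]
  field_simp

/-- The two charges differ. [folklore] -/
theorem topCharge_lineBackground_ne_balancedTwist (hL : 2 ≤ L) :
    topCharge (0 : Site 2 L) 0 1 (lineBackground L) ≠ topCharge (0 : Site 2 L) 0 1 (balancedTwist L) := by
  rw [topCharge_lineBackground hL, topCharge_balancedTwist hL]; norm_num

/-- **The line background is `2 sin(π/(2L))`-thin.** [folklore] -/
theorem dist_plaquetteHolonomy_lineBackground_le (hL : 2 ≤ L) (p : Plaquette 2 L) :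
    dist (plaquetteHolonomy (lineBackground L) p.1 p.2.1.1 p.2.1.2) 1 ≤ 2 * Real.sin (π / (2 * L)) := by
  have h := dist_plaquette_le_of_eq_exp (plaquetteHolonomy_lineBackground hL)
    (fun x => abs_lineRate_le hL (x 0).val) (pi_div_lt_pi hL).le p
  rwa [show π / (L : ℝ) / 2 = π / (2 * L) by ring] at h

/-- **The balanced twist is `2 sin(π/(2L))`-thin.** [folklore] -/
theorem dist_plaquetteHolonomy_balancedTwist_le (hL : 2 ≤ L) (p : Plaquette 2 L) :
    dist (plaquetteHolonomy (balancedTwist L) p.1 p.2.1.1 p.2.1.2) 1 ≤ 2 * Real.sin (π / (2 * L)) := by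
  have h := dist_plaquette_le_of_eq_exp (plaquetteHolonomy_balancedTwist hL)
    (fun x => abs_twistRate_le hL (x 0).val) (pi_div_lt_pi hL).le p
  rwa [show π / (L : ℝ) / 2 = π / (2 * L) by ring] at h

omit [NeZero L] in
/-- The background and the balanced twist agree off the wrapping line. [folklore] -/
theorem lineBackground_eq_balancedTwist_of_not_mem [NeZero L] {e : Edge 2 L}
    (he : e ∉ sliceLinks L) : lineBackground L e = balancedTwist L e :=
  mul_apply_eq_of_eq_one _ _ (sliceTwist_apply_of_not_mem he)

end Balanced

/-! ## §3. Necessity: no law on the wrapping line above `2 sin(π/(2L))` -/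

section Necessity

variable {L : ℕ} [NeZero L]

/-- **NO FLUX LAW ON A WRAPPING LINE ABOVE `2 sin(π/(2L))`.**  For `2 ≤ L`, `c > 2 sin(π/(2L))`
and ANY constant `C`, the law `(μ ⊗ κ){Q ≠ Q'} ≤ C·μ{∃ p, dist(U_p,1) ≥ c}` fails for some
`μ`-invariant Markov pair moving only `sliceLinks L`. [folklore] -/
theorem not_fluxLaw_sliceLinks_sharp (hL : 2 ≤ L) {c : ℝ} (hc : 2 * Real.sin (π / (2 * L)) < c)
    (C : ℝ≥0∞) :
    ¬ ∀ (μ : Measure (GaugeConfig 2 L Circle)) [IsProbabilityMeasure μ]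
        (κ : Kernel (GaugeConfig 2 L Circle) (GaugeConfig 2 L Circle)) [IsMarkovKernel κ],
        κ.Invariant μ → (∀ᵐ q ∂(μ ⊗ₘ κ), ∀ e ∉ sliceLinks L, q.1 e = q.2 e) →
        (μ ⊗ₘ κ) {q | topCharge (0 : Site 2 L) 0 1 q.1 ≠ topCharge (0 : Site 2 L) 0 1 q.2} ≤
          C * μ {W | ∃ p : Plaquette 2 L,
            c ≤ dist (plaquetteHolonomy W p.1 p.2.1.1 p.2.1.2) 1} :=
  not_fluxLaw_of_two (fun _ he => lineBackground_eq_balancedTwist_of_not_mem he)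
    (not_mem_thick_of_thin fun p => (dist_plaquetteHolonomy_lineBackground_le hL p).trans_lt hc)
    (not_mem_thick_of_thin fun p => (dist_plaquetteHolonomy_balancedTwist_le hL p).trans_lt hc)
    (topCharge_lineBackground_ne_balancedTwist hL) C

/-- **NO `ε`-SECTOR LAW ON A WRAPPING LINE ABOVE `2 sin(π/(2L))`** (`2 sin(π/(2L)) < ε ≤ 2`,
`c > 2 sin(π/(2L))`, any `C`) — the sharp form of `not_thinPlaquetteLaw_sliceLinks` of
`SliceTwistPair.lean` (there: `c > 2π/L`). [folklore] -/
theorem not_sectorLaw_sliceLinks_sharp (hL : 2 ≤ L) {c ε : ℝ}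
    (hc : 2 * Real.sin (π / (2 * L)) < c) (hε : 2 * Real.sin (π / (2 * L)) < ε) (hε2 : ε ≤ 2)
    (C : ℝ≥0∞) :
    ¬ ∀ (μ : Measure (GaugeConfig 2 L Circle)) [IsProbabilityMeasure μ]
        (κ : Kernel (GaugeConfig 2 L Circle) (GaugeConfig 2 L Circle)) [IsMarkovKernel κ],
        κ.Invariant μ → (∀ᵐ q ∂(μ ⊗ₘ κ), ∀ e ∉ sliceLinks L, q.1 e = q.2 e) →
        (μ ⊗ₘ κ) {q | connectedComponentIn (Thin L ε) q.1 ≠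
            connectedComponentIn (Thin L ε) q.2} ≤
          C * μ {W | ∃ p : Plaquette 2 L,
            c ≤ dist (plaquetteHolonomy W p.1 p.2.1.1 p.2.1.2) 1} :=
  not_sectorLaw_of_two (fun _ he => lineBackground_eq_balancedTwist_of_not_mem he)
    (not_mem_thick_of_thin fun p => (dist_plaquetteHolonomy_lineBackground_le hL p).trans_lt hc)
    (not_mem_thick_of_thin fun p => (dist_plaquetteHolonomy_balancedTwist_le hL p).trans_lt hc)
    (topCharge_lineBackground_ne_balancedTwist hL)
    (fun p => (dist_plaquetteHolonomy_lineBackground_le hL p).trans_lt hε)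
    (fun p => (dist_plaquetteHolonomy_balancedTwist_le hL p).trans_lt hε) hε2 C

/-- The plane positions whose plaquette touches the wrapping line: row `0`, `#P = L`. [folklore] -/
def linePositions (L : ℕ) [NeZero L] : Finset (ZMod L × ZMod L) :=
  ({0} : Finset (ZMod L)) ×ˢ (Finset.univ : Finset (ZMod L))

/-- `# linePositions = L`. [folklore] -/
theorem card_linePositions : (linePositions L).card = L := by
  simp [linePositions, ZMod.card]

/-- Membership in the line positions. [folklore] -/
theorem mem_linePositions {p : ZMod L × ZMod L} : p ∈ linePositions L ↔ p.1 = 0 := by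
  rw [linePositions, Finset.mem_product, Finset.mem_singleton]
  simp

omit [NeZero L] in
/-- The plane site of a position has first coordinate the first component. [folklore] -/
theorem planeSite_zero_apply [NeZero L] (p : ZMod L × ZMod L) : planeSite (0 : Site 2 L) 0 1 p 0 = p.1 := by
  simp [planeSite]

/-- The patch action of a row-like configuration on the line positions. [folklore] -/
theorem patchAction_linePositions_of_row {U : GaugeConfig 2 L Circle} {g : ℕ → ℝ}
    (hU : ∀ x : Site 2 L, abelianFieldTensor U x 0 1 = g (x 0).val) :
    patchAction (0 : Site 2 L) 0 1 (linePositions L) U = L * (1 - Real.cos (g 0)) := by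
  rw [patchAction_eq_sum_one_sub_cos, linePositions, Finset.sum_product, Finset.sum_singleton]
  simp only [hU, planeSite_zero_apply, ZMod.val_zero, Finset.sum_const, Finset.card_univ,
    ZMod.card, nsmul_eq_mul]

/-- **Both atoms sit exactly on the boundary of the sharp patch law**: their patch action on the
line positions is `L(1 - cos(π/L))`. [folklore] -/
theorem patchAction_lineBackground (hL : 2 ≤ L) :
    patchAction (0 : Site 2 L) 0 1 (linePositions L) (lineBackground L) = L * (1 - Real.cos (π / L)) ∧
    patchAction (0 : Site 2 L) 0 1 (linePositions L) (balancedTwist L) = L * (1 - Real.cos (π / L)) := by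
  refine ⟨?_, ?_⟩
  · rw [patchAction_linePositions_of_row (abelianFieldTensor_lineBackground hL), lineRate, if_pos rfl]
  · rw [patchAction_linePositions_of_row (abelianFieldTensor_balancedTwist hL), twistRate, if_pos rfl,
      Real.cos_neg]

/-- **THE SHARP PATCH LAW CANNOT BE RAISED.**  For `2 ≤ L`, every threshold
`t > L(1 - cos(π/L))` and every constant `C`, the law `(μ ⊗ κ){Q ≠ Q'} ≤ C·μ{S_P ≥ t}` on the line
positions `P` fails for some `μ`-invariant Markov pair moving only `sliceLinks L` — compare
`compProd_topCharge_ne_le_of_links_sharp` (`C = 2`, `t = #P·(1 - cos(π/#P))`). [folklore] -/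
theorem not_patchLaw_sliceLinks_sharp (hL : 2 ≤ L) {t : ℝ} (ht : L * (1 - Real.cos (π / L)) < t)
    (C : ℝ≥0∞) :
    ¬ ∀ (μ : Measure (GaugeConfig 2 L Circle)) [IsProbabilityMeasure μ]
        (κ : Kernel (GaugeConfig 2 L Circle) (GaugeConfig 2 L Circle)) [IsMarkovKernel κ],
        κ.Invariant μ → (∀ᵐ q ∂(μ ⊗ₘ κ), ∀ e ∉ sliceLinks L, q.1 e = q.2 e) →
        (μ ⊗ₘ κ) {q | topCharge (0 : Site 2 L) 0 1 q.1 ≠ topCharge (0 : Site 2 L) 0 1 q.2} ≤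
          C * μ {W | t ≤ patchAction (0 : Site 2 L) 0 1 (linePositions L) W} :=
  not_fluxLaw_of_two (fun _ he => lineBackground_eq_balancedTwist_of_not_mem he)
    (fun h => by have := (patchAction_lineBackground hL).1; simp only [Set.mem_setOf_eq] at h; linarith)
    (fun h => by have := (patchAction_lineBackground hL).2; simp only [Set.mem_setOf_eq] at h; linarith)
    (topCharge_lineBackground_ne_balancedTwist hL) C

end Necessity

/-! ## §4. Sufficiency: the flux law on the wrapping line at `2 sin(π/(2L))` -/

section Sufficiency

variable {L : ℕ} [NeZero L]

open Classical in
/-- The wrapping line as a finite link set. [folklore] -/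
def sliceFinset (L : ℕ) [NeZero L] : Finset (Edge 2 L) :=
  Finset.univ.filter (fun e => e.2 = 0 ∧ e.1 0 = 0)

/-- `sliceFinset` is `sliceLinks`. [folklore] -/
theorem mem_sliceFinset {e : Edge 2 L} : e ∈ sliceFinset L ↔ e ∈ sliceLinks L := by
  simp [sliceFinset, sliceLinks]

/-- Only plaquettes on row `0` touch the wrapping line. [folklore] -/
theorem mem_linePositions_of_touch (p : ZMod L × ZMod L)
    (h : ∃ e ∈ plaqLinks (planeSite (0 : Site 2 L) 0 1 p) 0 1, e ∈ sliceFinset L) :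
    p ∈ linePositions L := by
  have hx0 : (planeSite (0 : Site 2 L) 0 1 p) 0 = p.1 := planeSite_zero_apply p
  have hs0 : ((planeSite (0 : Site 2 L) 0 1 p).shift 1) 0 = p.1 := by
    rw [← hx0]; simp [Site.shift]
  obtain ⟨e, he, heΛ⟩ := h
  rw [mem_sliceFinset] at heΛ
  obtain ⟨h2, h1⟩ := heΛ
  rw [mem_linePositions]
  simp only [plaqLinks, Finset.mem_insert, Finset.mem_singleton] at he
  rcases he with rfl | rfl | rfl | rfl
  · rw [← hx0]; exact h1
  · simp at h2
  · rw [← hs0]; exact h1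
  · simp at h2

/-- **THE FLUX LAW ON A WRAPPING LINE AT THE SHARP THRESHOLD** (every `L ≥ 1`, every invariant
measure, `U(1)`, `d = 2`): a `μ`-invariant Markov pair moving only `sliceLinks L` changes the flux
charge with stationary probability `≤ 2·μ{∃ p, dist(U_p, 1) ≥ 2 sin(π/(2L))}`.  With
`not_fluxLaw_sliceLinks_sharp`: the admissible threshold is EXACTLY `2 sin(π/(2L))`. [folklore] -/
theorem fluxLaw_sliceLinks_sharp (μ : Measure (GaugeConfig 2 L Circle)) [SFinite μ]
    (κ : Kernel (GaugeConfig 2 L Circle) (GaugeConfig 2 L Circle)) [IsMarkovKernel κ]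
    (hinv : κ.Invariant μ) (hloc : ∀ᵐ q ∂(μ ⊗ₘ κ), ∀ e ∉ sliceLinks L, q.1 e = q.2 e) :
    (μ ⊗ₘ κ) {q | topCharge (0 : Site 2 L) 0 1 q.1 ≠ topCharge (0 : Site 2 L) 0 1 q.2} ≤
      2 * μ {U | ∃ p : Plaquette 2 L,
        2 * Real.sin (π / (2 * L)) ≤ dist (plaquetteHolonomy U p.1 p.2.1.1 p.2.1.2) 1} := by
  have hne : (linePositions L).Nonempty := ⟨(0, 0), mem_linePositions.mpr rfl⟩
  have h := compProd_topCharge_ne_le_of_links_maxPlaquette (0 : Site 2 L) 0 1 (sliceFinset L) hne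
    (mem_linePositions_of_touch) μ κ hinv (by
      filter_upwards [hloc] with q hq e he
      exact hq e (by rwa [mem_sliceFinset] at he))
  rw [card_linePositions] at h
  refine h.trans (mul_le_mul_right (measure_mono ?_) 2)
  rintro U ⟨p, -, hp⟩
  exact ⟨⟨planeSite (0 : Site 2 L) 0 1 p, ⟨(0, 1), by decide⟩⟩, hp⟩

/-- **THE LINE THRESHOLD, PINNED** (summary): at `c⋆ = 2 sin(π/(2L))` the flux law holds with
constant `2` for every invariant pair moving only the wrapping line, and for every `c > c⋆` no
constant works. [folklore] -/
theorem fluxThreshold_sliceLinks_pinned (hL : 2 ≤ L) :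
    (∀ (μ : Measure (GaugeConfig 2 L Circle)) [IsProbabilityMeasure μ]
        (κ : Kernel (GaugeConfig 2 L Circle) (GaugeConfig 2 L Circle)) [IsMarkovKernel κ],
        κ.Invariant μ → (∀ᵐ q ∂(μ ⊗ₘ κ), ∀ e ∉ sliceLinks L, q.1 e = q.2 e) →
        (μ ⊗ₘ κ) {q | topCharge (0 : Site 2 L) 0 1 q.1 ≠ topCharge (0 : Site 2 L) 0 1 q.2} ≤
          2 * μ {U | ∃ p : Plaquette 2 L,
            2 * Real.sin (π / (2 * L)) ≤ dist (plaquetteHolonomy U p.1 p.2.1.1 p.2.1.2) 1}) ∧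
    ∀ c : ℝ, 2 * Real.sin (π / (2 * L)) < c → ∀ C : ℝ≥0∞,
      ¬ ∀ (μ : Measure (GaugeConfig 2 L Circle)) [IsProbabilityMeasure μ]
          (κ : Kernel (GaugeConfig 2 L Circle) (GaugeConfig 2 L Circle)) [IsMarkovKernel κ],
          κ.Invariant μ → (∀ᵐ q ∂(μ ⊗ₘ κ), ∀ e ∉ sliceLinks L, q.1 e = q.2 e) →
          (μ ⊗ₘ κ) {q | topCharge (0 : Site 2 L) 0 1 q.1 ≠ topCharge (0 : Site 2 L) 0 1 q.2} ≤
            C * μ {W | ∃ p : Plaquette 2 L,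
              c ≤ dist (plaquetteHolonomy W p.1 p.2.1.1 p.2.1.2) 1} :=
  ⟨fun μ _ κ _ hinv hloc => fluxLaw_sliceLinks_sharp μ κ hinv hloc,
    fun _ hc C => not_fluxLaw_sliceLinks_sharp hL hc C⟩

end Sufficiency

end Summit.Ventures.LatticeQCDFlow.Theory2.Lattice.Flux
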